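import Summits.Ventures.PercRepro.Night2LocalD2R14Defs

/-!
# PercRepro — the column of R1₄ decomposed by preimage type (night-2, gen 15)

For the column bounds of the rule R1₄ (Night2LocalD2R14Defs) at a shadow set `S` of the coloop cell, the column
`Σ_B r14W M G B S` is split into its five parts (`sum_r14W_col_le_parts`):
* the IDENTITY part `(2/5)·#r14IdPre` — the covering preimages with `|G ∖ cl B| = 1`, `|B| ≥ 5`;
* the KEEP part `Σ_{r14KeepPre} r14Keep` — the covering preimages with `|G ∖ cl B| = 1`, `|B| = 4`;
* the COVERING part `Σ_{r14CovPre} r14Cov` — the covering preimages with `|G ∖ cl B| ≥ 2`;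
* the PAIR part `Σ_{r14PairPre} r14Pair` — the pair preimages with `|G ∖ cl B| ≥ 2`;
* the SPREAD part `r14Spread` — the layer-0 bases `B` with `S = B ∪ (G ∖ cl B) ∪ {x}`, `x ∈ cl B ∖ B`.
The spread part vanishes unless `|S| = 6` (`r14Spread_eq_zero`), the keep part unless `|S| = 5`
(`r14KeepPre_eq_empty`).
-/

namespace PercRepro.Shadow

open Finset PerFlat ThmH

variable {α : Type*} [DecidableEq α] {M : Matroid α} [M.Finite]

open scoped Classical in
/-- The identity preimages: covering preimages with `|G ∖ cl B| = 1` and `|B| ≥ 5`. -/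
noncomputable def r14IdPre (M : Matroid α) [M.Finite] (G S : Finset α) : Finset (Finset α) :=
  (coverPreimages M (Uq M (4 + 2) 4) G S).filter (fun B => (G \ clF M B).card = 1 ∧ 5 ≤ B.card)

open scoped Classical in
/-- The keep preimages: covering preimages with `|G ∖ cl B| = 1` and `|B| < 5`. -/
noncomputable def r14KeepPre (M : Matroid α) [M.Finite] (G S : Finset α) : Finset (Finset α) :=
  (coverPreimages M (Uq M (4 + 2) 4) G S).filter (fun B => (G \ clF M B).card = 1 ∧ ¬ 5 ≤ B.card)

open scoped Classical in
/-- The covering preimages with `|G ∖ cl B| ≥ 2`. -/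
noncomputable def r14CovPre (M : Matroid α) [M.Finite] (G S : Finset α) : Finset (Finset α) :=
  (coverPreimages M (Uq M (4 + 2) 4) G S).filter (fun B => ¬ (G \ clF M B).card = 1)

open scoped Classical in
/-- The pair preimages with `|G ∖ cl B| ≥ 2`. -/
noncomputable def r14PairPre (M : Matroid α) [M.Finite] (G S : Finset α) : Finset (Finset α) :=
  (pairPre M 4 G S).filter (fun B => ¬ (G \ clF M B).card = 1)

open scoped Classical in
/-- The spread part of the column at `S`. -/
noncomputable def r14Spread (M : Matroid α) [M.Finite] (G S : Finset α) : ℚ :=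
  ∑ B ∈ (membersIn M (Uq M (4 + 2) 4) G).filter (fun B => (G \ clF M B).card = 1 ∧ ¬ 5 ≤ B.card),
    ∑ x ∈ clF M B \ B, (if S = insert x (B ∪ (G \ clF M B)) then
      (2 / 5 - r14Keep M G B) / ((clF M B \ B).card : ℚ) else 0)

open scoped Classical in
/-- For one member, at most one 2-subset `P` of `G ∖ cl B` has `S = B ∪ P`: the sum of a constant over them is at
most the constant (`c ≥ 0`). -/
theorem sum_ite_union_le {G B : Finset α} (hB : B ∈ membersIn M (Uq M (4 + 2) 4) G) (S : Finset α) {c : ℚ}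
    (hc : 0 ≤ c) :
    ∑ P ∈ Finset.powersetCard 2 (G \ clF M B), (if S = B ∪ P then c else 0) ≤
      if (∃ P ∈ Finset.powersetCard 2 (G \ clF M B), S = B ∪ P) then c else 0 := by
  have hBU : B ∈ Uq M (4 + 2) 4 := (mem_membersIn.1 hB).1
  rw [← Finset.sum_filter]
  have hle : ((Finset.powersetCard 2 (G \ clF M B)).filter (fun P => S = B ∪ P)).card ≤ 1 := by
    rw [Finset.card_le_one]
    intro P hP P' hP'
    rw [Finset.mem_filter, Finset.mem_powersetCard] at hP hP'
    have key : ∀ Q, Q ⊆ G \ clF M B → S = B ∪ Q → Q = S \ B := by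
      intro Q hQ hSQ
      rw [hSQ, Finset.union_sdiff_left]
      symm
      rw [Finset.sdiff_eq_self_iff_disjoint, Finset.disjoint_left]
      intro e heQ heB
      exact (Finset.mem_sdiff.1 (hQ heQ)).2 (subset_clF hBU heB)
    rw [key P hP.1.1 hP.2, key P' hP'.1.1 hP'.2]
  rw [Finset.sum_const, nsmul_eq_mul]
  split_ifs with hex
  · have hcast : (((Finset.powersetCard 2 (G \ clF M B)).filter (fun P => S = B ∪ P)).card : ℚ) ≤ 1 := by
      exact_mod_cast hle
    calc _ ≤ (1 : ℚ) * c := mul_le_mul_of_nonneg_right hcast hc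
      _ = c := one_mul c
  · have hempty : (Finset.powersetCard 2 (G \ clF M B)).filter (fun P => S = B ∪ P) = ∅ := by
      rw [Finset.filter_eq_empty_iff]
      intro P hP hSP
      exact hex ⟨P, hP, hSP⟩
    rw [hempty, Finset.card_empty]
    simp

open scoped Classical in
/-- **The column of R1₄ split by preimage type.** -/
theorem sum_r14W_col_le_parts (G S : Finset α) :
    ∑ B ∈ membersIn M (Uq M (4 + 2) 4) G, r14W M G B S ≤
      ((r14IdPre M G S).card : ℚ) * (2 / 5) + ∑ B ∈ r14KeepPre M G S, r14Keep M G B +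
        ∑ B ∈ r14CovPre M G S, r14Cov M G B + ∑ B ∈ r14PairPre M G S, r14Pair M G B + r14Spread M G S := by
  -- the termwise bound
  have hterm : ∀ B ∈ membersIn M (Uq M (4 + 2) 4) G, r14W M G B S ≤
      (if B ∈ r14IdPre M G S then 2 / 5 else 0) + (if B ∈ r14KeepPre M G S then r14Keep M G B else 0) +
      (if B ∈ r14CovPre M G S then r14Cov M G B else 0) + (if B ∈ r14PairPre M G S then r14Pair M G B else 0) +
      (if (G \ clF M B).card = 1 ∧ ¬ 5 ≤ B.card then
        ∑ x ∈ clF M B \ B, (if S = insert x (B ∪ (G \ clF M B)) then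
          (2 / 5 - r14Keep M G B) / ((clF M B \ B).card : ℚ) else 0) else 0) := by
    intro B hB
    have hcp : B ∈ coverPreimages M (Uq M (4 + 2) 4) G S ↔ S ∈ coverSets M B G := by
      rw [mem_coverPreimages]
      exact ⟨fun h => h.2, fun h => ⟨hB, h⟩⟩
    have hpp : B ∈ pairPre M 4 G S ↔ ∃ P ∈ Finset.powersetCard 2 (G \ clF M B), S = B ∪ P := by
      rw [mem_pairPre]
      exact ⟨fun h => h.2, fun h => ⟨hB, h⟩⟩
    have hid : B ∈ r14IdPre M G S ↔ S ∈ coverSets M B G ∧ ((G \ clF M B).card = 1 ∧ 5 ≤ B.card) := by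
      unfold r14IdPre; rw [Finset.mem_filter, hcp]
    have hkp : B ∈ r14KeepPre M G S ↔ S ∈ coverSets M B G ∧ ((G \ clF M B).card = 1 ∧ ¬ 5 ≤ B.card) := by
      unfold r14KeepPre; rw [Finset.mem_filter, hcp]
    have hcv : B ∈ r14CovPre M G S ↔ S ∈ coverSets M B G ∧ ¬ (G \ clF M B).card = 1 := by
      unfold r14CovPre; rw [Finset.mem_filter, hcp]
    have hpr : B ∈ r14PairPre M G S ↔
        (∃ P ∈ Finset.powersetCard 2 (G \ clF M B), S = B ∪ P) ∧ ¬ (G \ clF M B).card = 1 := by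
      unfold r14PairPre; rw [Finset.mem_filter, hpp]
    have h2 := sum_ite_union_le hB S (r14Pair_nonneg (M := M) G B)
    have hk0 := r14Keep_nonneg (M := M) G B
    have hc0 := r14Cov_nonneg (M := M) G B
    have hp0 := r14Pair_nonneg (M := M) G B
    have hs0 : 0 ≤ ∑ x ∈ clF M B \ B, (if S = insert x (B ∪ (G \ clF M B)) then
        (2 / 5 - r14Keep M G B) / ((clF M B \ B).card : ℚ) else 0) := by
      apply Finset.sum_nonneg
      intro x _
      split_ifs
      · exact div_nonneg (by linarith [r14Keep_le (M := M) G B]) (by positivity)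
      · exact le_refl _
    have hps0 : 0 ≤ ∑ P ∈ Finset.powersetCard 2 (G \ clF M B), (if S = B ∪ P then r14Pair M G B else 0) := by
      apply Finset.sum_nonneg
      intro P _
      split_ifs
      · exact hp0
      · exact le_refl _
    unfold r14W
    simp only [hB, if_true, hid, hkp, hcv, hpr]
    by_cases hm : (G \ clF M B).card = 1 <;> by_cases h5 : 5 ≤ B.card <;> by_cases hcov : S ∈ coverSets M B G <;>
      by_cases hex : ∃ P ∈ Finset.powersetCard 2 (G \ clF M B), S = B ∪ P <;>
      simp only [hm, h5, hcov, hex, if_true, if_false, and_true, and_false,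
        not_true_eq_false, not_false_eq_true, and_self, zero_add, add_zero] at h2 ⊢ <;>
      linarith
  refine (Finset.sum_le_sum hterm).trans (le_of_eq ?_)
  rw [Finset.sum_add_distrib, Finset.sum_add_distrib, Finset.sum_add_distrib, Finset.sum_add_distrib]
  have hsub₁ : r14IdPre M G S ⊆ membersIn M (Uq M (4 + 2) 4) G := fun B hB =>
    (mem_coverPreimages.1 (Finset.mem_filter.1 hB).1).1
  have hsub₂ : r14KeepPre M G S ⊆ membersIn M (Uq M (4 + 2) 4) G := fun B hB =>
    (mem_coverPreimages.1 (Finset.mem_filter.1 hB).1).1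
  have hsub₃ : r14CovPre M G S ⊆ membersIn M (Uq M (4 + 2) 4) G := fun B hB =>
    (mem_coverPreimages.1 (Finset.mem_filter.1 hB).1).1
  have hsub₄ : r14PairPre M G S ⊆ membersIn M (Uq M (4 + 2) 4) G := fun B hB =>
    (mem_pairPre.1 (Finset.mem_filter.1 hB).1).1
  congr 1
  · congr 1
    · congr 1
      · congr 1
        · rw [Finset.sum_ite_mem, Finset.inter_eq_right.2 hsub₁, Finset.sum_const, nsmul_eq_mul]
        · rw [Finset.sum_ite_mem, Finset.inter_eq_right.2 hsub₂]
      · rw [Finset.sum_ite_mem, Finset.inter_eq_right.2 hsub₃]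
    · rw [Finset.sum_ite_mem, Finset.inter_eq_right.2 hsub₄]
  · unfold r14Spread
    rw [Finset.sum_filter]

/-- Every member has at least four elements. -/
theorem four_le_card_of_mem_membersIn {G B : Finset α} (hB : B ∈ membersIn M (Uq M (4 + 2) 4) G) : 4 ≤ B.card := by
  have := rkN_le_card_fin (M := M) B
  rw [rkN_eq_of_mem_Uq (mem_membersIn.1 hB).1] at this
  exact this

open scoped Classical in
/-- The spread part vanishes unless `|S| = 6`. -/
theorem r14Spread_eq_zero {G S : Finset α} (h6 : S.card ≠ 6) : r14Spread M G S = 0 := by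
  unfold r14Spread
  apply Finset.sum_eq_zero
  intro B hB
  rw [Finset.mem_filter] at hB
  obtain ⟨hBm, hm, h5⟩ := hB
  have hBU : B ∈ Uq M (4 + 2) 4 := (mem_membersIn.1 hBm).1
  have hB4 : B.card = 4 := by
    have := four_le_card_of_mem_membersIn hBm
    omega
  apply Finset.sum_eq_zero
  intro x hx
  rw [Finset.mem_sdiff] at hx
  have hxn : x ∉ B ∪ (G \ clF M B) := by
    rw [Finset.mem_union, Finset.mem_sdiff]
    push Not
    exact ⟨hx.2, fun _ => hx.1⟩
  have hdisj : Disjoint B (G \ clF M B) := by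
    rw [Finset.disjoint_left]
    intro e heB he
    exact (Finset.mem_sdiff.1 he).2 (subset_clF hBU heB)
  have hcard : (insert x (B ∪ (G \ clF M B))).card = 6 := by
    rw [Finset.card_insert_of_notMem hxn, Finset.card_union_of_disjoint hdisj, hB4, hm]
  have hne : S ≠ insert x (B ∪ (G \ clF M B)) := by
    intro h
    apply h6
    rw [h, hcard]
  simp only [hne, if_false]

open scoped Classical in
/-- The keep preimages vanish unless `|S| = 5`. -/
theorem r14KeepPre_eq_empty {G S : Finset α} (h5 : S.card ≠ 5) : r14KeepPre M G S = ∅ := by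
  rw [Finset.eq_empty_iff_forall_notMem]
  intro B hB
  unfold r14KeepPre at hB
  rw [Finset.mem_filter] at hB
  obtain ⟨hcp, hm, hlt⟩ := hB
  obtain ⟨hBm, hcov⟩ := mem_coverPreimages.1 hcp
  have hBU : B ∈ Uq M (4 + 2) 4 := (mem_membersIn.1 hBm).1
  have hB4 : B.card = 4 := by
    have := four_le_card_of_mem_membersIn hBm
    omega
  obtain ⟨z, hz, rfl⟩ := mem_coverSets.1 hcov
  have hzB : z ∉ B := notMem_of_notMem_clF hBU (Finset.mem_sdiff.1 hz).2
  apply h5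
  rw [Finset.card_insert_of_notMem hzB, hB4]

open scoped Classical in
/-- The identity preimages vanish unless `|S| ≥ 6`. -/
theorem r14IdPre_eq_empty {G S : Finset α} (h6 : S.card < 6) : r14IdPre M G S = ∅ := by
  rw [Finset.eq_empty_iff_forall_notMem]
  intro B hB
  unfold r14IdPre at hB
  rw [Finset.mem_filter] at hB
  obtain ⟨hcp, -, h5⟩ := hB
  obtain ⟨hBm, hcov⟩ := mem_coverPreimages.1 hcp
  have hBU : B ∈ Uq M (4 + 2) 4 := (mem_membersIn.1 hBm).1
  obtain ⟨z, hz, rfl⟩ := mem_coverSets.1 hcov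
  have hzB : z ∉ B := notMem_of_notMem_clF hBU (Finset.mem_sdiff.1 hz).2
  rw [Finset.card_insert_of_notMem hzB] at h6
  omega

end PercRepro.Shadow
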